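import Mathlib.RingTheory.MvPolynomial.Ideal
import Mathlib.Data.Finsupp.Weight
import Mathlib.Algebra.Polynomial.AlgebraMap
import Mathlib.Data.Fin.VecNotation
import Mathlib.Tactic
import Literature.AlgebraicGeometry.Hironaka2017.WQWitness
import Literature.AlgebraicGeometry.Hironaka2017.WQ3Witness
import HarnessLib

/-!
# Embedding dimension of a monomial curve: polynomials vanishing on `t ↦ (t^{w_1},…,t^{w_n})` lie in `𝔪₀²`

A characteristic-free, kernel-checked form of the folklore fact "the embedding dimension at the origin of the
monomial curve `γ_w : t ↦ (t^{w_1}, …, t^{w_n})` equals the number of minimal generators of the numerical semigroup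
`⟨w_1, …, w_n⟩`" [Herzog1970, §1–§2] in the direction used by resolution arguments: if every `w_i` is positive and
no `w_i` lies in the semigroup generated by the other exponents, then **every polynomial `F` over any commutative
ring `R` with `F(T^{w_1}, …, T^{w_n}) = 0` in `R[T]` lies in `(X_1, …, X_n)²`**
(`mem_idealOfVars_sq_of_monomialCurve_eq_zero`); over a domain the same holds for germs `F/G`, `G(0) ≠ 0`
(`mem_idealOfVars_sq_of_monomialCurve_mul_eq_zero`). Equivalently: no `F` of order exactly one at `0` — the local
equation of a hypersurface through `0` that is smooth at `0` — vanishes on `γ_w`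
(`monomialCurve_ne_zero_of_not_mem_sq`). The proof is the coefficient extraction
`coeff_{T^d} F(T^w) = Σ_{weight_w α = d} coeff_α F` (`coeff_monomialCurve`) at `d = 0` and `d = w_i`, where the
hypothesis makes `α = 0`, resp. `α = e_i`, the only exponent of that weight (`eq_zero_of_weight_eq_zero`,
`eq_single_of_weight_eq`).

## Instances: the two W-Q curves of the `pub-hironaka` adjudication (manuscript [Hironaka2017], UNREFEREED, D-0012 —
nothing from the manuscript is asserted here)
`WQ5`: `w = (99, 18, 20, 24, 29)`, the curve `γ = (t⁹⁹, t¹⁸, t²⁰, t²⁴, t²⁹) ⊂ 𝔸⁵` of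
`Literature.AlgebraicGeometry.Hironaka2017.WQWitness` (concern C18: `E = (x² + G, 2)`, characteristic 2); `WQ4`:
`w = (41, 9, 12, 13)`, the curve `γ = (s⁴¹, s⁹, s¹², s¹³) ⊂ 𝔸⁴` of `…Hironaka2017.WQ3Witness` (C-WQ3: `E = (x³ + G, 3)`,
characteristic 3). The semigroup hypotheses are exactly the Diophantine lemmas `edim_gamma_*` of those files; here they
are assembled into the ideal-theoretic statements `WQ5.mem_idealOfVars_sq` / `WQ4.mem_idealOfVars_sq` ("`I(γ) ⊆ 𝔪₀²`",
any `R`), the membership of the hypersurface equation in the kernel in the relevant characteristic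
(`WQ5.monomialCurve_fW`, `WQ4.monomialCurve_f`: `fW(γ(T)) = 8·T¹⁹⁸`, `f(γ(T)) = 9·T¹²³`), and the non-vanishing on
`γ` of every order-one germ (`WQ5.monomialCurve_ne_zero_of_not_mem_sq`, `WQ4.…`).

HOW THE ADJUDICATION READS THIS (prose; repair cell `pub-hironaka`, TYPER 2 gen 5, STEPS.md §B row B9′ / GAP.md):
granted the packet's `Inv ≡ Inv_max` along `γ` (C18 (ii), C-WQ3), `Sing(Ě) ⊇ γ ∋ 0` (manuscript Eq. (43) p.30), so at
`ξ = 0` no regular parameter `y` with `ord_0 y = 1` vanishes on `Sing(Ě) ∩ V` for any open `V ∋ 0`. Consequently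
(a) Def. 6.12 p.33 (Eq. (52): an LL-head `g = y^q + ε` on `V` with `ord_η y = 1` for ALL `η ∈ Sing(Ě) ∩ V_cl`) has no
instance on any `V ∋ 0`, although `f` is an edge generator at every point of `γ` (p.33: "a typical example of
`g ∈ L(Ě)_ξ` is any of the edge generators"); and (b) under the pointwise reading of (52), every LL-chain (83)–(84)
p.54–55 at `ξ = 0` has a tail `y(e)` of order `1` at `0` (items (7)–(8)), so its tail hypersurface `Y = {y(e) = 0}`
cannot contain `V ∩ Sing(Ě)` — the conclusion of Th. 10.4 p.60 (and Th. 10.3, first sentence) fails at `ξ = 0` for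
every chain, by dichotomy with Th. 9.18 (1) p.55 and independently of the `H♭`-recipe of §9. This module certifies
only the commutative algebra of `γ`; `S(E)`, `℘`, `Inv`, `Ě`, LL-chains are not formalised.
-/

namespace Literature.AlgebraicGeometry.Resolution

open MvPolynomial Finsupp

variable {σ R : Type*} [CommRing R]

/-! ## §1 The parametrisation `X_i ↦ T^{w_i}` and its coefficients -/

/-- The parametrisation `F ↦ F(T^{w_1}, …, T^{w_n})` of the monomial curve with exponent vector `w`, as an
`R`-algebra map `R[X_σ] → R[T]`; its kernel is the ideal of the curve. [folklore] -/
noncomputable def monomialCurve (w : σ → ℕ) : MvPolynomial σ R →ₐ[R] Polynomial R :=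
  aeval fun i => (Polynomial.X : Polynomial R) ^ w i

/-- `X_i ↦ T^{w_i}`. [folklore] -/
@[simp] theorem monomialCurve_X (w : σ → ℕ) (i : σ) :
    monomialCurve (R := R) w (X i) = Polynomial.X ^ w i := by
  simp [monomialCurve]

/-- A monomial `c·X^α` goes to `c·T^{weight_w α}`, `weight_w α = Σ_i α_i w_i`. [folklore] -/
theorem monomialCurve_monomial (w : σ → ℕ) (α : σ →₀ ℕ) (c : R) :
    monomialCurve w (monomial α c) = Polynomial.C c * Polynomial.X ^ weight w α := by
  rw [monomialCurve, aeval_monomial, Polynomial.algebraMap_eq]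
  congr 1
  rw [Finsupp.prod, weight_apply, Finsupp.sum]
  simp_rw [← pow_mul, smul_eq_mul]
  rw [Finset.prod_pow_eq_pow_sum]
  congr 1
  exact Finset.sum_congr rfl fun i _ => mul_comm _ _

/-- Coefficient extraction: the coefficient of `T^d` in `F(T^w)` is the sum of the coefficients of `F` over the
exponents of weight `d`. [folklore] -/
theorem coeff_monomialCurve (w : σ → ℕ) (F : MvPolynomial σ R) (d : ℕ) :
    (monomialCurve w F).coeff d = ∑ α ∈ F.support with weight w α = d, coeff α F := by
  have hF : monomialCurve w F = ∑ α ∈ F.support, monomialCurve w (monomial α (coeff α F)) := by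
    conv_lhs => rw [F.as_sum]
    rw [map_sum]
  rw [hF, Polynomial.finsetSum_coeff, Finset.sum_filter]
  refine Finset.sum_congr rfl fun α _ => ?_
  rw [monomialCurve_monomial, Polynomial.coeff_C_mul_X_pow]
  exact if_congr eq_comm rfl rfl

/-! ## §2 Numerical-semigroup bookkeeping -/

/-- With positive weights only the zero exponent has weight `0`. [folklore] -/
theorem eq_zero_of_weight_eq_zero (w : σ → ℕ) (hw : ∀ i, w i ≠ 0) {α : σ →₀ ℕ}
    (h : weight w α = 0) : α = 0 := by
  ext i
  have hle := le_weight w (hw i) α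
  rw [h] at hle
  simpa using hle

/-- With positive weights, an exponent `α` involving `X_i` and of weight `w_i` is `e_i`. [folklore] -/
theorem eq_single_of_weight_eq (w : σ → ℕ) (hw : ∀ j, w j ≠ 0) {i : σ} {α : σ →₀ ℕ}
    (hαi : α i ≠ 0) (h : weight w α = w i) : α = single i 1 := by
  have key : weight w (α - single i 1) + w i = weight w α := weight_sub_single_add hαi
  rw [h] at key
  have h0 : weight w (α - single i 1) = 0 := by omega
  have h1 : α - single i 1 = 0 := eq_zero_of_weight_eq_zero w hw h0
  rw [← sub_add_single_one_cancel hαi, h1, zero_add]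

/-- Exponents of total degree `< 2` are `0` or some `e_i`. [folklore] -/
theorem eq_zero_or_eq_single_of_degree_lt_two {α : σ →₀ ℕ} (h : degree α < 2) :
    α = 0 ∨ ∃ i, α = single i 1 := by
  by_cases h0 : α = 0
  · exact Or.inl h0
  right
  obtain ⟨i, hi⟩ : ∃ i, α i ≠ 0 := by
    by_contra hcon
    exact h0 (Finsupp.ext fun i => not_not.mp (not_exists.mp hcon i))
  refine ⟨i, eq_single_of_weight_eq (fun _ => 1) (fun _ => one_ne_zero) hi ?_⟩
  have h1 : α i ≤ degree α := le_degree i α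
  have hdeg : degree α = weight (fun _ => (1 : ℕ)) α := DFunLike.congr_fun degree_eq_weight_one α
  omega

/-! ## §3 The embedding-dimension statement -/

/-- If `β` is the only exponent of its weight, `coeff_β F` is the `T^{weight β}`-coefficient of `F(T^w)`. [folklore] -/
theorem coeff_eq_coeff_monomialCurve (w : σ → ℕ) (F : MvPolynomial σ R) {β : σ →₀ ℕ}
    (hβ : ∀ α, weight w α = weight w β → α = β) :
    coeff β F = (monomialCurve w F).coeff (weight w β) := by
  classical
  rw [coeff_monomialCurve]
  have hfilter : ∀ α ∈ F.support, weight w α = weight w β ↔ α = β :=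
    fun α _ => ⟨hβ α, fun h => h ▸ rfl⟩
  rw [Finset.filter_congr hfilter, Finset.sum_filter, Finset.sum_ite_eq']
  split_ifs with hmem
  · rfl
  · simpa [MvPolynomial.mem_support_iff] using hmem

/-- … hence vanishes when `F` vanishes on the curve. [folklore] -/
theorem coeff_eq_zero_of_monomialCurve_eq_zero (w : σ → ℕ) {F : MvPolynomial σ R}
    (hF : monomialCurve w F = 0) {β : σ →₀ ℕ} (hβ : ∀ α, weight w α = weight w β → α = β) :
    coeff β F = 0 := by
  rw [coeff_eq_coeff_monomialCurve w F hβ, hF, Polynomial.coeff_zero]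

/-- **Embedding dimension of a monomial curve (kernel-checked direction).** Let `w : σ → ℕ` have all `w_i > 0` and
no `w_i` in the semigroup generated by the other exponents (`hmin`: no exponent vector avoiding `X_i` has weight `w_i`).
Then every polynomial vanishing on `t ↦ (t^{w_i})_i` — i.e. in the kernel of `X_i ↦ T^{w_i}` — lies in
`(X_i : i ∈ σ)²`: the curve has embedding dimension `#σ` at the origin. [cite: Herzog1970, §1] -/
theorem mem_idealOfVars_sq_of_monomialCurve_eq_zero (w : σ → ℕ) (hw : ∀ i, w i ≠ 0)
    (hmin : ∀ i (α : σ →₀ ℕ), α i = 0 → weight w α ≠ w i)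
    {F : MvPolynomial σ R} (hF : monomialCurve w F = 0) :
    F ∈ idealOfVars σ R ^ 2 := by
  rw [mem_pow_idealOfVars_iff']
  intro β hβ
  apply coeff_eq_zero_of_monomialCurve_eq_zero w hF
  intro α hα
  rcases eq_zero_or_eq_single_of_degree_lt_two hβ with rfl | ⟨i, rfl⟩
  · rw [map_zero] at hα
    exact eq_zero_of_weight_eq_zero w hw hα
  · rw [weight_single, smul_eq_mul, one_mul] at hα
    have hαi : α i ≠ 0 := fun h0 => hmin i α h0 hα
    exact eq_single_of_weight_eq w hw hαi hα

/-- Contrapositive: no polynomial of order exactly one at the origin (`F ∉ 𝔪₀²`; for `F ∈ 𝔪₀` this is the local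
equation of a hypersurface smooth at `0`) vanishes on the curve. [folklore] -/
theorem monomialCurve_ne_zero_of_not_mem_sq (w : σ → ℕ) (hw : ∀ i, w i ≠ 0)
    (hmin : ∀ i (α : σ →₀ ℕ), α i = 0 → weight w α ≠ w i)
    {F : MvPolynomial σ R} (hF : F ∉ idealOfVars σ R ^ 2) : monomialCurve w F ≠ 0 :=
  fun h => hF (mem_idealOfVars_sq_of_monomialCurve_eq_zero w hw hmin h)

/-- Germ version over a domain: if `F·G` vanishes on the curve and `G(0) ≠ 0` (so `F/G ∈ O_{𝔸ⁿ,0}` and `F/G`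
vanishes on the curve germ), then `F ∈ 𝔪₀²`. [folklore] -/
theorem mem_idealOfVars_sq_of_monomialCurve_mul_eq_zero [IsDomain R] (w : σ → ℕ) (hw : ∀ i, w i ≠ 0)
    (hmin : ∀ i (α : σ →₀ ℕ), α i = 0 → weight w α ≠ w i)
    {F G : MvPolynomial σ R} (hFG : monomialCurve w (F * G) = 0) (hG : constantCoeff G ≠ 0) :
    F ∈ idealOfVars σ R ^ 2 := by
  rw [map_mul, mul_eq_zero] at hFG
  rcases hFG with hF | hG0
  · exact mem_idealOfVars_sq_of_monomialCurve_eq_zero w hw hmin hF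
  · exfalso
    have hG2 := mem_idealOfVars_sq_of_monomialCurve_eq_zero w hw hmin hG0
    rw [mem_pow_idealOfVars_iff'] at hG2
    apply hG
    have h00 : coeff 0 G = 0 := hG2 0 (by simp)
    rwa [← MvPolynomial.constantCoeff_eq] at h00

/-! ## §4 Instance `WQ5`: `γ = (t⁹⁹, t¹⁸, t²⁰, t²⁴, t²⁹) ⊂ 𝔸⁵` (C18, `…Hironaka2017.WQWitness`) -/

namespace WQ5

/-- The exponent vector `(99, 18, 20, 24, 29)` of the C18 curve. [folklore] -/
def w : Fin 5 → ℕ := ![99, 18, 20, 24, 29]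

/-- All exponents are positive. [folklore] -/
theorem w_ne_zero : ∀ i, w i ≠ 0 := by decide

/-- `weight_w α = 99α₀ + 18α₁ + 20α₂ + 24α₃ + 29α₄`. [folklore] -/
theorem weight_w (α : Fin 5 →₀ ℕ) :
    weight w α = α 0 * 99 + α 1 * 18 + α 2 * 20 + α 3 * 24 + α 4 * 29 := by
  rw [weight_apply, Finsupp.sum_fintype α (fun i c => c • w i) (fun i => zero_smul ℕ (w i))]
  simp [Fin.sum_univ_five, w]

/-- Minimality of the generators: no exponent avoiding `X_i` has weight `w_i` — the five Diophantine lemmas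
`WQWitness.edim_gamma_*`. [folklore] -/
theorem w_minimal : ∀ (i : Fin 5) (α : Fin 5 →₀ ℕ), α i = 0 → weight w α ≠ w i := by
  intro i α hi h
  rw [weight_w] at h
  fin_cases i
  all_goals norm_num [w] at h
  · change α 0 = 0 at hi
    exact Hironaka2017.WQWitness.edim_gamma_99 (α 1) (α 2) (α 3) (α 4) (by omega)
  · change α 1 = 0 at hi
    exact Hironaka2017.WQWitness.edim_gamma_18 (α 0) (α 2) (α 3) (α 4) (by omega)
  · change α 2 = 0 at hi
    exact Hironaka2017.WQWitness.edim_gamma_20 (α 0) (α 1) (α 3) (α 4) (by omega)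
  · change α 3 = 0 at hi
    exact Hironaka2017.WQWitness.edim_gamma_24 (α 0) (α 1) (α 2) (α 4) (by omega)
  · change α 4 = 0 at hi
    exact Hironaka2017.WQWitness.edim_gamma_29 (α 0) (α 1) (α 2) (α 3) (by omega)

/-- `I(γ) ⊆ 𝔪₀²` for the C18 curve, over any commutative ring: `edim₀ γ = 5`. [folklore] -/
theorem mem_idealOfVars_sq {F : MvPolynomial (Fin 5) R} (hF : monomialCurve w F = 0) :
    F ∈ idealOfVars (Fin 5) R ^ 2 :=
  mem_idealOfVars_sq_of_monomialCurve_eq_zero w w_ne_zero w_minimal hF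

/-- No order-one polynomial (local equation of a hypersurface smooth at `0`) vanishes on the C18 curve. [folklore] -/
theorem monomialCurve_ne_zero_of_not_mem_sq {F : MvPolynomial (Fin 5) R} (hF : F ∉ idealOfVars (Fin 5) R ^ 2) :
    monomialCurve w F ≠ 0 :=
  Resolution.monomialCurve_ne_zero_of_not_mem_sq w w_ne_zero w_minimal hF

/-- Germ version (`R` a domain, e.g. the perfect ground field): `F·G|_γ = 0`, `G(0) ≠ 0` ⇒ `F ∈ 𝔪₀²`. [folklore] -/
theorem mem_idealOfVars_sq_of_mul [IsDomain R] {F G : MvPolynomial (Fin 5) R}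
    (hFG : monomialCurve w (F * G) = 0) (hG : constantCoeff G ≠ 0) : F ∈ idealOfVars (Fin 5) R ^ 2 :=
  mem_idealOfVars_sq_of_monomialCurve_mul_eq_zero w w_ne_zero w_minimal hFG hG

/-- `fW(γ(T)) = 8·T¹⁹⁸` (`fW = x² + G` quasi-homogeneous of weight `198`): in characteristic 2 the curve lies on the
hypersurface of C18. [folklore] -/
theorem monomialCurve_fW : monomialCurve w (Hironaka2017.WQWitness.fW (R := R)) = 8 * Polynomial.X ^ 198 := by
  simp only [Hironaka2017.WQWitness.fW, map_add, map_mul, map_pow, monomialCurve_X, w]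
  simp only [Fin.isValue, Matrix.cons_val_zero, Matrix.cons_val_one, Matrix.cons_val]
  ring

/-- In characteristic 2, `fW` lies in the ideal of `γ` (the kernel of the parametrisation). [folklore] -/
theorem monomialCurve_fW_char2 (h2 : (2 : R) = 0) : monomialCurve w (Hironaka2017.WQWitness.fW (R := R)) = 0 := by
  rw [monomialCurve_fW, show (8 : Polynomial R) = Polynomial.C (2 * 2 * 2) by norm_num [map_ofNat], h2]
  simp

/-- … while the coordinate `x = X 0` (order one) does not vanish on `γ`: `x(γ(T)) = T⁹⁹`. [folklore] -/
theorem monomialCurve_x : monomialCurve w (X 0 : MvPolynomial (Fin 5) R) = Polynomial.X ^ 99 := by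
  simp [w]

end WQ5

/-! ## §5 Instance `WQ4`: `γ = (s⁴¹, s⁹, s¹², s¹³) ⊂ 𝔸⁴` (C-WQ3, `…Hironaka2017.WQ3Witness`) -/

namespace WQ4

/-- The exponent vector `(41, 9, 12, 13)` of the C-WQ3 curve. [folklore] -/
def w : Fin 4 → ℕ := ![41, 9, 12, 13]

/-- All exponents are positive. [folklore] -/
theorem w_ne_zero : ∀ i, w i ≠ 0 := by decide

/-- `weight_w α = 41α₀ + 9α₁ + 12α₂ + 13α₃`. [folklore] -/
theorem weight_w (α : Fin 4 →₀ ℕ) :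
    weight w α = α 0 * 41 + α 1 * 9 + α 2 * 12 + α 3 * 13 := by
  rw [weight_apply, Finsupp.sum_fintype α (fun i c => c • w i) (fun i => zero_smul ℕ (w i))]
  simp [Fin.sum_univ_four, w]

/-- Minimality of the generators (`WQ3Witness.edim_gamma_*`). [folklore] -/
theorem w_minimal : ∀ (i : Fin 4) (α : Fin 4 →₀ ℕ), α i = 0 → weight w α ≠ w i := by
  intro i α hi h
  rw [weight_w] at h
  fin_cases i
  all_goals norm_num [w] at h
  · change α 0 = 0 at hi
    exact Hironaka2017.WQ3Witness.edim_gamma_41 (α 1) (α 2) (α 3) (by omega)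
  · change α 1 = 0 at hi
    exact Hironaka2017.WQ3Witness.edim_gamma_9 (α 0) (α 2) (α 3) (by omega)
  · change α 2 = 0 at hi
    exact Hironaka2017.WQ3Witness.edim_gamma_12 (α 0) (α 1) (α 3) (by omega)
  · change α 3 = 0 at hi
    exact Hironaka2017.WQ3Witness.edim_gamma_13 (α 0) (α 1) (α 2) (by omega)

/-- `I(γ) ⊆ 𝔪₀²` for the C-WQ3 curve, over any commutative ring: `edim₀ γ = 4`. [folklore] -/
theorem mem_idealOfVars_sq {F : MvPolynomial (Fin 4) R} (hF : monomialCurve w F = 0) :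
    F ∈ idealOfVars (Fin 4) R ^ 2 :=
  mem_idealOfVars_sq_of_monomialCurve_eq_zero w w_ne_zero w_minimal hF

/-- No order-one polynomial vanishes on the C-WQ3 curve. [folklore] -/
theorem monomialCurve_ne_zero_of_not_mem_sq {F : MvPolynomial (Fin 4) R} (hF : F ∉ idealOfVars (Fin 4) R ^ 2) :
    monomialCurve w F ≠ 0 :=
  Resolution.monomialCurve_ne_zero_of_not_mem_sq w w_ne_zero w_minimal hF

/-- Germ version over a domain. [folklore] -/
theorem mem_idealOfVars_sq_of_mul [IsDomain R] {F G : MvPolynomial (Fin 4) R}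
    (hFG : monomialCurve w (F * G) = 0) (hG : constantCoeff G ≠ 0) : F ∈ idealOfVars (Fin 4) R ^ 2 :=
  mem_idealOfVars_sq_of_monomialCurve_mul_eq_zero w w_ne_zero w_minimal hFG hG

/-- `f(γ(T)) = 9·T¹²³` (`f = x³ + G` quasi-homogeneous of weight `123`): in characteristic 3 the curve lies on the
hypersurface of C-WQ3 (cf. `WQ3Witness.f_on_gamma`, the same identity inside `MvPolynomial (Fin 5) R`). [folklore] -/
theorem monomialCurve_f : monomialCurve w (Hironaka2017.WQ3Witness.f (R := R)) = 9 * Polynomial.X ^ 123 := by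
  simp only [Hironaka2017.WQ3Witness.f, Hironaka2017.WQ3Witness.G, map_add, map_mul, map_pow, monomialCurve_X, w]
  simp only [Fin.isValue, Matrix.cons_val_zero, Matrix.cons_val_one, Matrix.cons_val]
  ring

/-- In characteristic 3, `f` lies in the ideal of `γ`. [folklore] -/
theorem monomialCurve_f_char3 (h3 : (3 : R) = 0) : monomialCurve w (Hironaka2017.WQ3Witness.f (R := R)) = 0 := by
  rw [monomialCurve_f, show (9 : Polynomial R) = Polynomial.C (3 * 3) by norm_num [map_ofNat], h3]
  simp

/-- `x(γ(T)) = T⁴¹ ≠ 0`. [folklore] -/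
theorem monomialCurve_x : monomialCurve w (X 0 : MvPolynomial (Fin 4) R) = Polynomial.X ^ 41 := by
  simp [w]

end WQ4

end Literature.AlgebraicGeometry.Resolution
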